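import Summits.ABC.IUTFork.Joshi.PrototypeWittModelValues
import Summits.ABC.IUTFork.Joshi.PrimitiveAnsatzPointsClassical
import Summits.ABC.IUTFork.Joshi.LogLinkTransportPeriodicPoints
import Mathlib.Algebra.MvPolynomial.Variables
import HarnessLib

/-!
# W6, part 2 — a JOINT kernel model of the print-shaped [J-IIp] §10.13 package over E-t3's signature: E-t2's `EtaPtTeich` ∧ a BIJECTIVE
# point-Frobenius ∧ the Witt–Teichmüller law `ϕ([a]) = [a^p]` ∧ a §10.13 `FrobeniusTransport` at EVERY CLASSICAL point (and at no junk
# fixed point) ∧ Rmk. 7.4.3 — given ONE `ClassLift`; a model exhibits satisfiability of TYPED hypotheses, nothing more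

Test-side support file of the abc-iut cell, block E «type Joshi's construction, test vs S» (rung LADDER-ABC:A2.E; seat abc-iut-E-t50
gen 5; W6 of abc-iut-E-cx-2's VACUITY column, CLAIM 2026-08-26T13:31:38Z; part 1 = `Joshi/PrototypeWittModelValues.lean`). Everything over
E-t3's HYPOTHESIS signature `PeriodRingDatum` / `PrototypeDatum` (`Joshi/ThetaValuesLocus`, `Joshi/PrimitiveAnsatz`, p427971) and BY NAME:
E-t2's `EtaPtTeich` / `liftsOf` / `LiftCosetsNotFrobStable` (`Joshi/MochizukiAnsatzLocal`) and `classicalPts` (p436515); E-t7's §10.13 input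
structure `FrobeniusTransport` (p430819), its `scale_frobY_of_transport` / `absK_residueIso` (LogLinkInsertedIsometry) and binder `hφ`;
E-t57's point set `JointModel.Pt` (p441701); E-t52's norm-by-variables idea (p445632); this seat's boundary theorem p447117. Source of the
hypotheses: K. Joshi, arXiv:2303.01662v3 (`paper:arxiv-2303.01662`, bib `Joshi2023ATS2Local`, UNREFEREED — typed AS A CANDIDATE):
§10.13 p. 33 l. 1–12 (cell render p0033) «`ϕ(𝔪_{y_{n−1}}) = 𝔪_{ϕ(y_{n−1})} = 𝔪_{y_n}` … `ϕ([a] − p) = [ϕ(a)] − p = [a^p] − p`»; Lem. 6.10.1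
p. 18; Rmk. 7.4.3 p. 21 l. 34. TAKES NO SIDE on [IUTchIII] Cor. 3.12, on Joshi's claims, or on Mochizuki's reports on them; no FACT-LIST
row; no Prop hypothesis beyond the DATA `Λ : ClassLift p`; nothing about print asserted; typed ≠ proved ≠ endorsed. [folklore] model-building.

WHY (the column so far). p441701 (E-t57): `EtaPtTeich` ∧ bijective `ϕ`, `φ = id`. p446419 (E-t7 g5, W5): + `φ_B` induces `ϕ`, transports
at EVERY `y : Y` — hence (p447117, this seat) NOT the Witt law `ϕ([a]) = [a^p]`, which no datum with transports everywhere can carry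
(junk `ϕ`-fixed points `pt 0`, `pt 1`). p445632 (E-t52, `TeichFrobModel`): the Witt law ∧ transports at non-classical column points. W6 =
the PRINT-SHAPED conjunction: `EtaPtTeich` ∧ bijective `ϕ` ∧ Witt law ∧ transports exactly on print's locus `|Y_{F,ℚ_p}|` = `classicalPts`.

THE MODEL (given `Λ`). `B := MvPolynomial Q̄_p Q̄_p` — one variable `X_a` per `a ∈ F := Q̄_p`, the formal Teichmüller `[a] := X_a`,
coefficients in `Q̄_p` FIXED by `φ := rename (a ↦ a^p)` (so `φ(X_a) = X_{a^p}`: the Witt law BY CONSTRUCTION; `B^{φ=p} = 0` here — the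
eigen-upgrade needs E-t52's shifted coefficients and is not attempted); norm `|f|_ρ := max ‖a‖` over the variables of `f` (E-t52's device:
ultrametric, `|X_a| = ‖a‖`, `B⁺` `φ`-stable); points `Y := Q̄_p/∼` with `pt := [−]`, `ϕ([a]) := [a^p]` (bijective, p441701), `K_y := (Q̄_p,
‖·‖^{sc e(y)})`, `T_y := {0}`, Galois trivial; and **`η_y := eval (L_y)`** with part 1's value map `L_y`. Then `η_{ϕ(w)} ∘ φ = eval (L_{ϕ w} ∘
(·)^p) = eval (L_w) = η_w` at every classical `w` (part 1 `value_frobPerm`) — §10.13's transport with `φ` a ring map and equal kernels; `EtaPtTeich` is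
part 1's `value_diag`; (A1)/(A2) are `norm_value_rpow` / `value_surjective`. Logical model (`G = Unit`, `T_y = {0}`, one external choice `Λ`), not
arithmetic-faithful; continuity unmodelled (no topology in the signature).

RESULTS (parametric in `Λ : ClassLift p`; an inhabitant of `ClassLift p` is supplied separately — E-t52 g4 by cardinality / this seat from
the Iwasawa logarithm of `ℚ̄_p`): `etaPtTeich`, `frobY_bijective`, `frob_teich` (E-t7's `hφ`), `transport hw` / `nonempty_transport_of_mem_classicalPts`
(§10.13 at EVERY classical class), `isEmpty_transport_pt_one` (and at NO junk fixed point — p447117 applied to this datum: the quantifier is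
sharp), `scale_frobY` / `absK_residueIso` (E-t7's conditional consequences, now unconditional at classical classes), `liftCosetsNotFrobStable`
(Rmk. 7.4.3), packaged **`w6_package`**. NOT here: `B^{φ=p} ≠ 0`, `char F = p`, a non-trivial Tate module, any claim about Joshi's or
Mochizuki's mathematics.
-/

noncomputable section

open Function Set MvPolynomial
open scoped Classical

namespace Summit.ABC.IUTFork.Joshi.JointModel.Witt

variable {p : ℕ} [hp : Fact p.Prime] (Λ : ClassLift p)

variable (p) in
/-- `0 < ‖p‖ < 1` in `Q̄_p` (private local copy, as in part 1 / p441701). [folklore] -/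
private theorem norm_p_pos_lt_one : 0 < ‖(p : PadicAlgCl p)‖ ∧ ‖(p : PadicAlgCl p)‖ < 1 := by
  have := (JointModel.periodRingDatum p).abs0_p
  rwa [show (JointModel.periodRingDatum p).abs0 = Model.absOne p from rfl, Model.absOne_apply] at this

/-! ## 4. The period ring `B := MvPolynomial Q̄_p Q̄_p` (formal Teichmüllers `X_a`, coefficients FIXED by `φ`), its norm and Frobenius -/

variable (p) in
/-- The model period ring. [folklore] -/
abbrev Ring : Type := MvPolynomial (PadicAlgCl p) (PadicAlgCl p)

variable (p) in
/-- **The Frobenius `φ := rename (a ↦ a^p)`** — `φ(X_a) = X_{a^p}` (the Witt–Teichmüller law by construction), coefficients fixed;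
an algebra endomorphism. [folklore] -/
def frobAlg : Ring p →ₐ[PadicAlgCl p] Ring p := rename fun a : PadicAlgCl p => a ^ p

variable (p) in
/-- `φ(X_a) = X_{a^p}`. [folklore] -/
theorem frobAlg_X (a : PadicAlgCl p) : frobAlg p (X a) = X (a ^ p) := rename_X _ a

variable (p) in
/-- The model norm `|f| := max ‖a‖` over the variables `X_a` occurring in `f` (as in E-t52's p445632). [folklore] -/
def vnorm (f : Ring p) : ℝ := ((f.vars.sup fun a => ‖a‖₊ : NNReal) : ℝ)

variable (p) in
/-- `|f| ≥ 0`. [folklore] -/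
theorem vnorm_nonneg (f : Ring p) : 0 ≤ vnorm p f := NNReal.coe_nonneg _

variable (p) in
/-- `|f + g| ≤ max(|f|, |g|)`. [folklore] -/
theorem vnorm_add (f g : Ring p) : vnorm p (f + g) ≤ max (vnorm p f) (vnorm p g) := by
  classical
  simp only [vnorm, ← NNReal.coe_max, NNReal.coe_le_coe]
  exact (Finset.sup_mono (vars_add_subset f g)).trans (le_of_eq Finset.sup_union)

variable (p) in
/-- `|X_a| = ‖a‖`. [folklore] -/
theorem vnorm_X (a : PadicAlgCl p) : vnorm p (X a) = ‖a‖ := by simp [vnorm, vars_X]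

variable (p) in
/-- `|0| ≤ 1`. [folklore] -/
theorem vnorm_zero_le : vnorm p 0 ≤ 1 := by simp [vnorm, vars_0]

variable (p) in
/-- `B⁺` is `φ`-stable: the variables of `φ f` are `p`-th powers of variables of `f`. [folklore] -/
theorem vnorm_frob_le_one {f : Ring p} (h : vnorm p f ≤ 1) : vnorm p (frobAlg p f) ≤ 1 := by
  classical
  simp only [vnorm, ← NNReal.coe_one, NNReal.coe_le_coe] at h ⊢
  refine Finset.sup_le fun b hb => ?_
  obtain ⟨a, ha, rfl⟩ := Finset.mem_image.1 (vars_rename _ _ hb)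
  have ha' : ‖a‖₊ ≤ 1 := (Finset.le_sup (f := fun a => ‖a‖₊) ha).trans h
  rw [nnnorm_pow]
  exact pow_le_one₀ (by simp) ha'

/-! ## 5. The datum over E-t3's signature -/

/-- **The W6 period-ring datum** (given `Λ`): `B = MvPolynomial Q̄_p Q̄_p`, `[a] := X_a`, `φ := rename (·^p)`, `Y := Q̄_p/∼` with
`pt := [−]`, `ϕ([a]) := [a^p]`, `K_y := (Q̄_p, ‖·‖^{sc e(y)})`, `η_y := eval (L_y)`, `T_y := {0}`, Galois trivial. [folklore] -/
def periodRingDatum : PeriodRingDatum (PadicAlgCl p) (Ring p) (PadicAlgCl p) (Pt p) (fun _ => PadicAlgCl p) Unit where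
  p := p
  p_prime := hp.out
  absF := Model.absOne p
  norm _ := vnorm p
  norm_nonneg _ := vnorm_nonneg p
  norm_add_le _ := vnorm_add p
  teich := X
  norm_teich _ x _ _ := by rw [Model.absOne_apply]; exact vnorm_X p x
  gal _ := id
  frob := frobAlg p
  gal_norm_one _ _ h := h
  frob_norm_one _ h := vnorm_frob_le_one p h
  absK w := Model.absPow p (ExpModel.sc (e p w)) (ExpModel.sc_pos _)
  eta w := MvPolynomial.eval (value Λ w)
  absK_eta_teich w x := by
    show ‖MvPolynomial.eval (value Λ w) (X x)‖ ^ ExpModel.sc (e p w) = ‖x‖ ^ (1 : ℝ)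
    rw [eval_X, Real.rpow_one]; exact norm_value_rpow Λ w x
  exists_teich_lift w ξ _ := by
    obtain ⟨x, hx⟩ := value_surjective Λ w ξ
    exact ⟨x, by show MvPolynomial.eval (value Λ w) (X x) = ξ; rw [eval_X, hx]⟩
  T _ := {0}
  zero_mem_T _ := rfl
  eta_T _ τ hτ := by rw [Set.mem_singleton_iff.1 hτ, map_zero]
  T_norm_one _ τ hτ := by rw [Set.mem_singleton_iff.1 hτ]; exact vnorm_zero_le p
  pt := mk p
  frobY := frobPt p
  pt_frob _ := rfl
  galF _ := RingHom.id _
  absF_galF _ _ := rfl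
  galY _ := id
  pt_gal _ _ := rfl
  abs0 := Model.absOne p
  abs0_p := by rw [Model.absOne_apply]; exact norm_p_pos_lt_one p
  emb _ := RingHom.id _
  scale w := ExpModel.sc (e p w)
  scale_pos w := ExpModel.sc_pos _
  absK_emb w z := by
    show ‖z‖ ^ ExpModel.sc (e p w) = (Model.absOne p z) ^ ExpModel.sc (e p w)
    rw [Model.absOne_apply]
  absK_pt a ha0 ha1 := by
    show ‖(p : PadicAlgCl p)‖ ^ ExpModel.sc (e p (mk p a)) = Model.absOne p a
    rw [Model.absOne_apply] at ha1 ⊢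
    rw [e_mk]
    exact norm_p_rpow_sc p ⟨norm_pos_iff.2 ha0, ha1⟩

/-- **The W6 prototype datum**: `ℓ⋆ = 2`, `q_E := p^{10}`, `ξ := p` (p441701's choices). [folklore] -/
def prototypeDatum : PrototypeDatum (PadicAlgCl p) (Ring p) (PadicAlgCl p) (Pt p) (fun _ => PadicAlgCl p) Unit where
  toPeriodRingDatum := periodRingDatum Λ
  lstar := 2
  one_le_lstar := by norm_num
  q := (p : PadicAlgCl p) ^ 10
  abs0_q := by
    show 0 < Model.absOne p _ ∧ Model.absOne p _ < 1
    rw [Model.absOne_apply, norm_pow]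
    exact ⟨pow_pos (norm_p_pos_lt_one p).1 _, pow_lt_one₀ (norm_nonneg _) (norm_p_pos_lt_one p).2 (by norm_num)⟩
  xi := p
  abs0_xi := by
    show Model.absOne p (p : PadicAlgCl p) = (Model.absOne p ((p : PadicAlgCl p) ^ 10)) ^ (1 / (2 * ((2 * 2 + 1 : ℕ) : ℝ)))
    rw [Model.absOne_apply, Model.absOne_apply, norm_pow]
    have h : (1 / (2 * ((2 * 2 + 1 : ℕ) : ℝ))) = ((10 : ℕ) : ℝ)⁻¹ := by norm_num
    rw [h, Real.pow_rpow_inv_natCast (norm_nonneg _) (by norm_num)]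

/-! ## 6. The four W6 properties at ONE datum: `EtaPtTeich`, bijective `ϕ`, the Witt–Teichmüller law, transports on `classicalPts` -/

/-- **E-t2's `EtaPtTeich` HOLDS**: `η_{[a]}([a]) = L_{[a]}(a) = p` for admissible `a` (the diagonal swap). [folklore] -/
theorem etaPtTeich : (prototypeDatum Λ).EtaPtTeich := by
  intro a ha0 ha1
  show MvPolynomial.eval (value Λ (mk p a)) (X a) = (p : PadicAlgCl p)
  rw [eval_X]
  have ha : Adm p a := ⟨norm_pos_iff.2 ha0, by rwa [show (prototypeDatum Λ).absF = Model.absOne p from rfl, Model.absOne_apply] at ha1⟩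
  exact value_diag Λ (by rw [e_mk]; exact ExpModel.expQ_pos p ha.1 ha.2) rfl

/-- **The point-Frobenius is a BIJECTION** (p441701). [folklore] -/
theorem frobY_bijective : Bijective (prototypeDatum Λ).frobY := frobPt_bijective p

/-- **The Witt–Teichmüller law `ϕ([a]) = [a^p]` HOLDS** (`rename_X`) — E-t7's binder `hφ` of `Joshi/LogLinkInsertedIsometry`. [folklore] -/
theorem frob_teich (a : PadicAlgCl p) :
    (prototypeDatum Λ).frob ((prototypeDatum Λ).teich a) = (prototypeDatum Λ).teich (a ^ (prototypeDatum Λ).p) :=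
  frobAlg_X p a

/-- `η_{ϕ(w)} ∘ φ = η_w` as ring maps at every CLASSICAL class (`e(w) > 0`): `eval (L_{σ w}) ∘ rename (·^p) = eval (L_{σ w} ∘ (·^p)) =
eval (L_w)`. [folklore] -/
theorem eta_comp_frob {w : Pt p} (hw : 0 < e p w) :
    ((prototypeDatum Λ).eta ((prototypeDatum Λ).frobY w)).comp (frobAlg p).toRingHom = (prototypeDatum Λ).eta w := by
  refine RingHom.ext fun f => ?_
  show MvPolynomial.eval (value Λ (frobPt p w)) (rename (fun a : PadicAlgCl p => a ^ p) f) = MvPolynomial.eval (value Λ w) f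
  rw [eval_rename, show (value Λ (frobPt p w) ∘ fun a : PadicAlgCl p => a ^ p) = value Λ w from funext fun c => value_frobPerm Λ hw c]

/-- Every `η_w` is onto (constants). [folklore] -/
theorem eta_surjective (w : Pt p) : Surjective ((prototypeDatum Λ).eta w) := fun k =>
  ⟨C k, by show MvPolynomial.eval (value Λ w) (C k) = k; rw [eval_C]⟩

/-- **§10.13's `FrobeniusTransport` (p430819) at every CLASSICAL class** (`e(w) > 0`): `φ` is a ring map, both `η` onto, and
`ker(η_{ϕ w} ∘ φ) = ker η_w` because the two maps are EQUAL. [folklore] -/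
def transport {w : Pt p} (hw : 0 < e p w) : (prototypeDatum Λ).FrobeniusTransport w where
  frobHom := (frobAlg p).toRingHom
  frobHom_eq _ := rfl
  eta_surj := eta_surjective Λ w
  eta_frob_surj := by rw [eta_comp_frob Λ hw]; exact eta_surjective Λ w
  ker_eq := by rw [eta_comp_frob Λ hw]

/-- `e([a]) > 0` for admissible `a`. [folklore] -/
theorem e_pos_of_adm {a : PadicAlgCl p} (ha : Adm p a) : 0 < e p (mk p a) := by
  rw [e_mk]; exact ExpModel.expQ_pos p ha.1 ha.2

/-- **Transports on ALL of print's locus `|Y_{F,ℚ_p}|`** = E-t2's `classicalPts` (the classes `[a]`, `0 ≠ a ∈ 𝔪_F`). [folklore] -/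
theorem nonempty_transport_of_mem_classicalPts {w : Pt p} (hw : w ∈ (prototypeDatum Λ).classicalPts) :
    Nonempty ((prototypeDatum Λ).FrobeniusTransport w) := by
  obtain ⟨a, ha0, ha1, rfl⟩ := hw
  have ha : Adm p a := ⟨norm_pos_iff.2 ha0, by rwa [show (prototypeDatum Λ).absF = Model.absOne p from rfl, Model.absOne_apply] at ha1⟩
  exact ⟨transport Λ (e_pos_of_adm ha)⟩

/-- … and, as it must be (p447117 `PeriodRingDatum.isEmpty_frobeniusTransport_pt_one`: the Witt law holds here), NO transport at the
junk `ϕ`-fixed class `pt 1 = [1]` — the quantifier «on `classicalPts`» is sharp. [folklore] -/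
theorem isEmpty_transport_pt_one : IsEmpty ((prototypeDatum Λ).FrobeniusTransport ((prototypeDatum Λ).pt 1)) :=
  (prototypeDatum Λ).isEmpty_frobeniusTransport_pt_one (frob_teich Λ)

/-! ## 7. Consequences by the lineage's landed implications; Rmk. 7.4.3 -/

/-- Along `ϕ` the valuation exponent scales by `p` (E-t7's `scale_frobY_of_transport`, now UNCONDITIONALLY at classical classes). [folklore] -/
theorem scale_frobY {w : Pt p} (hw : 0 < e p w) :
    (prototypeDatum Λ).scale ((prototypeDatum Λ).frobY w) = (prototypeDatum Λ).p * (prototypeDatum Λ).scale w :=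
  PeriodRingDatum.scale_frobY_of_transport (transport Λ hw) (frob_teich Λ)

/-- `|σ_w ξ|_{K_{ϕ w}} = |ξ|^p_{K_w}` for the Frobenius residue isomorphism at every classical class (E-t7's `absK_residueIso`). [folklore] -/
theorem absK_residueIso {w : Pt p} (hw : 0 < e p w) (ξ : PadicAlgCl p) :
    (prototypeDatum Λ).absK ((prototypeDatum Λ).frobY w) ((transport Λ hw).residueIso ξ) = (prototypeDatum Λ).absK w ξ ^ (prototypeDatum Λ).p :=
  PeriodRingDatum.absK_residueIso (transport Λ hw) (frob_teich Λ) ξ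

/-- **E-t2's Rmk. 7.4.3 claim-Prop `LiftCosetsNotFrobStable` HOLDS**: at `w = [p]`, `φ([p]) = [p^p]` is not a lift of `η_{[p]}([p])`
(`X` is injective and `‖L_w(p^p)‖ = ‖p‖^p ≠ ‖p‖ = ‖L_w(p)‖`). [claim: Joshi2023ATS2Local, status: disputed] -/
theorem liftCosetsNotFrobStable : (prototypeDatum Λ).LiftCosetsNotFrobStable := by
  have hadm : Adm p (p : PadicAlgCl p) := norm_p_pos_lt_one p
  have hw : 0 < e p (mk p (p : PadicAlgCl p)) := e_pos_of_adm hadm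
  refine ⟨mk p (p : PadicAlgCl p), (prototypeDatum Λ).eta (mk p (p : PadicAlgCl p)) ((prototypeDatum Λ).teich (p : PadicAlgCl p)),
    fun hsub => ?_⟩
  have hmem : (prototypeDatum Λ).teich (p : PadicAlgCl p) ∈ (prototypeDatum Λ).liftsOf (mk p (p : PadicAlgCl p))
      ((prototypeDatum Λ).eta (mk p (p : PadicAlgCl p)) ((prototypeDatum Λ).teich (p : PadicAlgCl p))) :=
    Set.mem_iUnion₂.2 ⟨(p : PadicAlgCl p), rfl, (prototypeDatum Λ).teich_mem_liftCoset _ _⟩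
  obtain ⟨x', hx'ξ, τ', hτ', hx'⟩ := Set.mem_iUnion₂.1 (hsub (Set.mem_image_of_mem (prototypeDatum Λ).frob hmem))
  have hτ0 : τ' = 0 := hτ'
  rw [hτ0, zero_add] at hx'
  -- `φ(X_p) = X_{p^p} = X_{x'}`, so `x' = p^p`
  have hx'eq : x' = (p : PadicAlgCl p) ^ p := by
    have h := hx'
    change frobAlg p (X (p : PadicAlgCl p)) = X x' at h
    rw [frobAlg_X] at h
    exact (X_injective h).symm
  -- but then `L_w(p^p) = L_w(p)`, contradicting the norms
  have hval : value Λ (mk p (p : PadicAlgCl p)) x' = value Λ (mk p (p : PadicAlgCl p)) (p : PadicAlgCl p) := by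
    have h := hx'ξ
    change MvPolynomial.eval (value Λ _) (X x') = MvPolynomial.eval (value Λ _) (X (p : PadicAlgCl p)) at h
    rwa [eval_X, eval_X] at h
  have hn := congr_arg (‖·‖) hval
  simp only [norm_value Λ hw, hx'eq, norm_pow] at hn
  have he1 : e p (mk p (p : PadicAlgCl p)) = 1 := by rw [e_mk, ExpModel.expQ_p]
  rw [he1] at hn
  norm_num at hn
  exact absurd hn (pow_lt_self_of_lt_one₀ (norm_p_pos_lt_one p).1 (norm_p_pos_lt_one p).2 hp.out.one_lt).ne

/-! ## 8. PACKAGED: W6 — given one `ClassLift`, the print-shaped §10.13 package is jointly satisfied -/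

/-- **PACKAGED (W6).** At ONE datum over E-t3's signature (for any norm-preserving class-surjection `Λ`): E-t2's `EtaPtTeich` ∧ the
point-Frobenius is BIJECTIVE ∧ the Witt–Teichmüller law `ϕ([a]) = [a^p]` ∧ p430819's `FrobeniusTransport` at EVERY point of print's locus
`classicalPts` (and at NO junk fixed point, p447117) ∧ E-t2's `LiftCosetsNotFrobStable`. A model exhibits joint satisfiability of TYPED
hypotheses, nothing more; logical (`G = Unit`, `T_y = {0}`, `B^{φ=p} = 0` not excluded here), not arithmetic-faithful; continuity unmodelled. [folklore] -/
theorem w6_package :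
    (prototypeDatum Λ).EtaPtTeich ∧ Bijective (prototypeDatum Λ).frobY ∧
      (∀ a, (prototypeDatum Λ).frob ((prototypeDatum Λ).teich a) = (prototypeDatum Λ).teich (a ^ (prototypeDatum Λ).p)) ∧
      (∀ w ∈ (prototypeDatum Λ).classicalPts, Nonempty ((prototypeDatum Λ).FrobeniusTransport w)) ∧
      IsEmpty ((prototypeDatum Λ).FrobeniusTransport ((prototypeDatum Λ).pt 1)) ∧
      (prototypeDatum Λ).LiftCosetsNotFrobStable :=
  ⟨etaPtTeich Λ, frobY_bijective Λ, frob_teich Λ, fun _ hw => nonempty_transport_of_mem_classicalPts Λ hw,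
    isEmpty_transport_pt_one Λ, liftCosetsNotFrobStable Λ⟩

end Summit.ABC.IUTFork.Joshi.JointModel.Witt

end
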